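import Literature.MathematicalPhysics.StatisticalMechanics.BarlowStackingEnergy

/-!
# `PeriodicGivenLayered` (stmt-AtomisticToContinuum-11779), line `Sketch`, helper: alternating majorisation

Support file for the crux `PhononSlackCertificates.PeriodicGivenLayered` (= `HullMinimality.PeriodicGivenLayered`),
line `Sketch` (card `alternating-majorisation-one-crossing`, crux-ideate r1 ideator 2; proof adapted verbatim from the
ideator's `IdeatorTwoMajorisationProof.lean` in the crux workfiles).

`haggLocalEnergy_alternating_add_deficit_le`: for couplings `J k ≤ 0` non-decreasing from `k = 2` on (attractive
on-top registry, weakening with the layer distance) and ANY Hägg word `s`, the forward registry energy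
`haggLocalEnergy J s m` of every layer `m` is at least that of the alternating word (`ABAB…`) plus the deficit
`J 3 - J 2 ≥ 0` whenever layers `m, m+2` are not aligned (a stacking fault at `m`). Proof = the injective pairing
`(2j, 2j+1)` of layer distances under the hard-core rule "aligned layers are never adjacent"
(`not_haggAligned_succ_of_haggAligned`): at most one of each pair is aligned and the weights weaken, so the even
distances (all aligned for `ABAB`) majorise. Potential-free; the Lennard-Jones input (sign and monotonicity of the
registry coupling at free spacings) is a separate stub of the line.

References: L. Bétermin, M. Petrache, *Dimension reduction techniques for the minimization of theta functions on
lattices*, J. Math. Phys. 58 (2017), Thm 1.1 and Steps 2.1–2.3 (the pairing); L. B. Pártay, C. Ortner et al.,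
PCCP 19 (2017), App. A (Hägg words and the interlayer expansion).
-/

namespace Summit.AtomisticToContinuum.Crystallization.Theorems.LayeredHull

open Finset
open Literature.MathematicalPhysics.StatisticalMechanics

variable {s : ℤ → ℤ} {J : ℕ → ℝ}

/-- Hard core of the coincidence set: layers aligned with layer `m` are never adjacent. -/
theorem not_haggAligned_succ_of_haggAligned (hs : IsHaggSeq s) (m : ℤ) (k : ℕ)
    (h : HaggAligned s m k) : ¬ HaggAligned s m (k + 1) := by
  change haggWindow s m k % 3 = 0 at h
  change ¬ (haggWindow s m (k + 1) % 3 = 0)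
  rw [haggWindow_succ]
  rcases hs (m + k) with h1 | h1 <;> rw [h1] <;> omega

/-- The pair `(k, k+1)`, `k ≥ 2`: at most one coincidence, and the weights weaken. -/
theorem pair_le (hs : IsHaggSeq s) (hJ0 : ∀ k, 2 ≤ k → J k ≤ 0)
    (hmono : ∀ k, 2 ≤ k → J k ≤ J (k + 1)) (m : ℤ) {k : ℕ} (hk : 2 ≤ k) :
    J k ≤ (if HaggAligned s m k then J k else 0) + (if HaggAligned s m (k + 1) then J (k + 1) else 0) := by
  by_cases h1 : HaggAligned s m k
  · have h2 := not_haggAligned_succ_of_haggAligned hs m k h1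
    rw [if_pos h1, if_neg h2, add_zero]
  · by_cases h2 : HaggAligned s m (k + 1)
    · rw [if_neg h1, if_pos h2, zero_add]
      exact hmono k hk
    · rw [if_neg h1, if_neg h2, add_zero]
      exact hJ0 k hk

/-- The first pair `(2, 3)` carries the deficit. -/
theorem pair_two_le (hs : IsHaggSeq s) (hJ0 : ∀ k, 2 ≤ k → J k ≤ 0) (m : ℤ) :
    J 2 + (J 3 - J 2) * (if HaggAligned s m 2 then (0 : ℝ) else 1)
      ≤ (if HaggAligned s m 2 then J 2 else 0) + (if HaggAligned s m 3 then J 3 else 0) := by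
  by_cases h1 : HaggAligned s m 2
  · have h2 := not_haggAligned_succ_of_haggAligned hs m 2 h1
    rw [if_pos h1, if_pos h1, if_neg h2]
    ring_nf
    exact le_rfl
  · by_cases h2 : HaggAligned s m 3
    · rw [if_neg h1, if_neg h1, if_pos h2]
      ring_nf
      exact le_rfl
    · rw [if_neg h1, if_neg h1, if_neg h2]
      have := hJ0 3 (by norm_num)
      linarith

/-- Odd truncations `K = 2n + 1`, `n ≥ 1`. -/
theorem odd_case (hs : IsHaggSeq s) (hJ0 : ∀ k, 2 ≤ k → J k ≤ 0)
    (hmono : ∀ k, 2 ≤ k → J k ≤ J (k + 1)) (m : ℤ) :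
    ∀ n : ℕ, 1 ≤ n →
      (∑ k ∈ Icc 2 (2 * n + 1), if Even k then J k else 0)
          + (J 3 - J 2) * (if HaggAligned s m 2 then (0 : ℝ) else 1)
        ≤ ∑ k ∈ Icc 2 (2 * n + 1), if HaggAligned s m k then J k else 0 := by
  intro n hn
  induction n with
  | zero => omega
  | succ n ih =>
    rcases Nat.lt_or_ge n 1 with h0 | h0
    · -- n = 0: K = 3
      obtain rfl : n = 0 := by omega
      have e1 : (Icc 2 (2 * (0 + 1) + 1) : Finset ℕ) = {2, 3} := by decide
      rw [e1, sum_pair (by norm_num), sum_pair (by norm_num)]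
      have h2 : Even 2 := by decide
      have h3 : ¬ Even 3 := by decide
      rw [if_pos h2, if_neg h3, add_zero]
      exact pair_two_le hs hJ0 m
    · have ih' := ih h0
      have hev : Even (2 * n + 1 + 1) := ⟨n + 1, by ring⟩
      have hod : ¬ Even (2 * n + 1 + 1 + 1) := by
        rw [Nat.not_even_iff_odd]; exact ⟨n + 1, by ring⟩
      have eK : 2 * (n + 1) + 1 = 2 * n + 1 + 1 + 1 := by ring
      have A : (∑ k ∈ Icc 2 (2 * (n + 1) + 1), if Even k then J k else 0)
          = (∑ k ∈ Icc 2 (2 * n + 1), if Even k then J k else 0) + J (2 * n + 1 + 1) := by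
        rw [eK, sum_Icc_succ_top (a := 2) (b := 2 * n + 1 + 1) (by omega),
          sum_Icc_succ_top (a := 2) (b := 2 * n + 1) (by omega), if_pos hev, if_neg hod, add_zero]
      have B : (∑ k ∈ Icc 2 (2 * (n + 1) + 1), if HaggAligned s m k then J k else 0)
          = (∑ k ∈ Icc 2 (2 * n + 1), if HaggAligned s m k then J k else 0)
            + ((if HaggAligned s m (2 * n + 1 + 1) then J (2 * n + 1 + 1) else 0)
              + (if HaggAligned s m (2 * n + 1 + 1 + 1) then J (2 * n + 1 + 1 + 1) else 0)) := by
        rw [eK, sum_Icc_succ_top (a := 2) (b := 2 * n + 1 + 1) (by omega),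
          sum_Icc_succ_top (a := 2) (b := 2 * n + 1) (by omega), add_assoc]
      have hp := pair_le hs hJ0 hmono m (k := 2 * n + 1 + 1) (by omega)
      rw [A, B]
      linarith

/-- **Alternating majorisation, truncated form.** For `J k ≤ 0` and `J k ≤ J (k+1)` (`k ≥ 2`), every Hägg
word `s`, every layer `m` and every range `K ≥ 2`:
`haggLocalEnergyTrunc K J alternatingHagg m + (J 3 - J 2)·1[¬ aligned(m,2)] ≤ haggLocalEnergyTrunc K J s m`. -/
theorem haggLocalEnergyTrunc_alternating_add_deficit_le (hs : IsHaggSeq s)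
    (hJ0 : ∀ k, 2 ≤ k → J k ≤ 0) (hmono : ∀ k, 2 ≤ k → J k ≤ J (k + 1)) (m : ℤ) {K : ℕ}
    (hK : 2 ≤ K) :
    haggLocalEnergyTrunc K J alternatingHagg m + (J 3 - J 2) * (if HaggAligned s m 2 then (0 : ℝ) else 1)
      ≤ haggLocalEnergyTrunc K J s m := by
  -- rewrite the alternating side as the even-indexed sum
  have halt : haggLocalEnergyTrunc K J alternatingHagg m = ∑ k ∈ Icc 2 K, if Even k then J k else 0 := by
    unfold haggLocalEnergyTrunc
    refine sum_congr rfl fun k _ => ?_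
    by_cases h : Even k
    · rw [if_pos h, if_pos ((haggAligned_alternating_iff m k).2 h)]
    · rw [if_neg h, if_neg (fun h' => h ((haggAligned_alternating_iff m k).1 h'))]
  rw [halt]
  unfold haggLocalEnergyTrunc
  obtain ⟨n, rfl | rfl⟩ := Nat.even_or_odd' K
  · -- K = 2n even, n ≥ 1
    rcases Nat.lt_or_ge n 2 with hn | hn
    · -- n = 1: K = 2
      obtain rfl : n = 1 := by omega
      have e1 : (Icc 2 (2 * 1) : Finset ℕ) = {2} := by decide
      rw [e1, sum_singleton, sum_singleton]
      have h2 : Even 2 := by decide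
      rw [if_pos h2]
      by_cases h1 : HaggAligned s m 2
      · rw [if_pos h1, if_pos h1]
        linarith
      · rw [if_neg h1, if_neg h1]
        have := hJ0 3 (by norm_num)
        linarith
    · -- n ≥ 2: K = 2n = (2(n-1)+1) + 1
      obtain ⟨n', rfl⟩ : ∃ n', n = n' + 1 := ⟨n - 1, by omega⟩
      have eK : 2 * (n' + 1) = 2 * n' + 1 + 1 := by ring
      have hev : Even (2 * n' + 1 + 1) := ⟨n' + 1, by ring⟩
      have A : (∑ k ∈ Icc 2 (2 * (n' + 1)), if Even k then J k else 0)
          = (∑ k ∈ Icc 2 (2 * n' + 1), if Even k then J k else 0) + J (2 * n' + 1 + 1) := by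
        rw [eK, sum_Icc_succ_top (a := 2) (b := 2 * n' + 1) (by omega), if_pos hev]
      have B : (∑ k ∈ Icc 2 (2 * (n' + 1)), if HaggAligned s m k then J k else 0)
          = (∑ k ∈ Icc 2 (2 * n' + 1), if HaggAligned s m k then J k else 0)
            + (if HaggAligned s m (2 * n' + 1 + 1) then J (2 * n' + 1 + 1) else 0) := by
        rw [eK, sum_Icc_succ_top (a := 2) (b := 2 * n' + 1) (by omega)]
      have ih := odd_case hs hJ0 hmono m n' (by omega)
      have hlast : J (2 * n' + 1 + 1)
          ≤ (if HaggAligned s m (2 * n' + 1 + 1) then J (2 * n' + 1 + 1) else 0) := by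
        by_cases h1 : HaggAligned s m (2 * n' + 1 + 1)
        · rw [if_pos h1]
        · rw [if_neg h1]; exact hJ0 _ (by omega)
      rw [A, B]
      linarith
  · -- K = 2n+1 odd, n ≥ 1
    exact odd_case hs hJ0 hmono m n (by omega)

end Summit.AtomisticToContinuum.Crystallization.Theorems.LayeredHull

namespace Summit.AtomisticToContinuum.Crystallization.Theorems.LayeredHull

open Finset Filter
open scoped Topology
open Literature.MathematicalPhysics.StatisticalMechanics

variable {s : ℤ → ℤ} {J : ℕ → ℝ}

/-- Partial sums over `range (K+1)` of the masked sequence are the truncated local energies. -/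
theorem sum_range_succ_ite_eq (P : ℕ → Prop) [DecidablePred P] (J : ℕ → ℝ) :
    ∀ K : ℕ, (∑ k ∈ range (K + 1), if 2 ≤ k ∧ P k then J k else 0)
      = ∑ k ∈ Icc 2 K, if P k then J k else 0 := by
  intro K
  induction K with
  | zero =>
    rw [sum_range_one]
    have : (Icc 2 0 : Finset ℕ) = ∅ := by decide
    rw [this, sum_empty]
    simp
  | succ K ih =>
    rw [sum_range_succ, ih]
    rcases Nat.lt_or_ge K 1 with hK | hK
    · obtain rfl : K = 0 := by omega
      have e0 : (Icc 2 0 : Finset ℕ) = ∅ := by decide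
      have e1 : (Icc 2 (0 + 1) : Finset ℕ) = ∅ := by decide
      rw [e0, e1, sum_empty]
      simp
    · rw [sum_Icc_succ_top (a := 2) (b := K) (by omega)]
      congr 1
      by_cases hP : P (K + 1)
      · rw [if_pos ⟨by omega, hP⟩, if_pos hP]
      · rw [if_neg (fun h => hP h.2), if_neg hP]

/-- **Alternating majorisation** (all ranges): for summable couplings `J` with `J k ≤ 0` and
`J k ≤ J (k+1)` for `k ≥ 2`, every Hägg word `s` and every layer `m`,
`haggLocalEnergy J alternatingHagg m + (J 3 - J 2)·1[¬ aligned(m,2)] ≤ haggLocalEnergy J s m`.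
This is `AlternatingMajorisation` of `Sketch.lean`, now a theorem. -/
theorem haggLocalEnergy_alternating_add_deficit_le (hs : IsHaggSeq s) (hJ : Summable J)
    (hJ0 : ∀ k, 2 ≤ k → J k ≤ 0) (hmono : ∀ k, 2 ≤ k → J k ≤ J (k + 1)) (m : ℤ) :
    haggLocalEnergy J alternatingHagg m + (J 3 - J 2) * (if HaggAligned s m 2 then (0 : ℝ) else 1)
      ≤ haggLocalEnergy J s m := by
  -- both sides are limits of partial sums over `range (K+1)`
  have hs_sum : Summable fun k => if 2 ≤ k ∧ HaggAligned s m k then J k else 0 :=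
    summable_ite_of_summable hJ _
  have ha_sum : Summable fun k => if 2 ≤ k ∧ HaggAligned alternatingHagg m k then J k else 0 :=
    summable_ite_of_summable hJ _
  have t1 := (ha_sum.tendsto_sum_tsum_nat).comp (tendsto_add_atTop_nat 1)
  have t2 := (hs_sum.tendsto_sum_tsum_nat).comp (tendsto_add_atTop_nat 1)
  have t1' := t1.add_const ((J 3 - J 2) * (if HaggAligned s m 2 then (0 : ℝ) else 1))
  refine le_of_tendsto_of_tendsto t1' t2 ?_
  rw [EventuallyLE, eventually_atTop]
  refine ⟨2, fun K hK => ?_⟩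
  simp only [Function.comp]
  rw [sum_range_succ_ite_eq, sum_range_succ_ite_eq]
  exact haggLocalEnergyTrunc_alternating_add_deficit_le hs hJ0 hmono m hK

end Summit.AtomisticToContinuum.Crystallization.Theorems.LayeredHull
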